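import Summits.CriticalPhenomena.PercolationContinuityZ3.Theorems.PercNearOneGluingNoHeavyLowerTailKnQuestion8CoefficientwiseCoreClassOneSidedRootSlice
import HarnessLib

/-!
# The one-sided root inequality for bundles, IV: the induction

Support file (`--supports stmt-CriticalPhenomena-4575`, closed), prover `prim-cplus-coupling` (gen 33).  No definitions, no named facts, no sorries;
standard axioms.  Memo `prim-cplus-coupling/A5-COUPLING-gen33.md` §1.  Steps in `…CoreClassOneSidedRootSteps` / `…CoreClassOneSidedRootSlice`.

* `Coefficientwise.osr_degLeTwo_core` — for an edge set `E` in which every vertex `∉ {c, a}` lies on at most two edges (and without loops), the generalized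
  sum `S(E, R, Run)` is `≥ 0` for every `R ⊆ E` of absorbed edges (every vertex `∉ {c, a}` on an edge of `R` has all its `E`-edges in `R`) and every tied
  run `Run ⊆ E ∖ R` at `c` (edges on `W ∪ {c, tip}`, `W` private and joined to `c` by the run), all monotone `H ≥ Hᵇ`, `K ≥ Kᵇ`.
  Induction on `μ = 2|E ∖ R| − |Run|`: BASE (no free edge at `c`), PICK (`Run = ∅`: tie the first edge of an arm), THREAD (`tip = a`: absorb the red run
  into `R`), FREE BIT (`tip = c` with `Run ≠ ∅`, or a dead end: average over the run colour), and otherwise SPLIT along the next edge `f` of the arm into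
  the longer run `Run + f` and the SLICE (run and `f` of opposite colours, averaged over the run colour); the averaged levels stay monotone with `H̄ᵇ ≤ H̄`.
The specialization `R = Run = ∅` is THEOREM OSR-Θ (`…CoreClassOneSidedRootBundle`).
[cite: KozmaNitzan2024, Questions 8–9 (§5.5 p. 36) (context: the Question-8 pocket covariance programme)]
-/

namespace Summit.CriticalPhenomena.PercolationContinuityZ3.Theorems

open Finset Literature.Probability.Percolation

namespace Coefficientwise

variable {ι V : Type*}

open Classical in
/-- **The induction behind THEOREM OSR-Θ.**  See the module docstring: internal degree `≤ 2`, no loops, absorbed edges `R`, tied run `Run` with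
vertex data `W, tip`; conclusion `S(E, R, Run) ≥ 0` for all monotone `H ≥ Hᵇ`, `K ≥ Kᵇ`, by induction on `n ≥ 2|E ∖ R| − |Run|`.
[cite: KozmaNitzan2024, Questions 8–9 (§5.5 p. 36) (context)] -/
theorem osr_degLeTwo_core (ends : ι → Sym2 V) (c a : V) (hca : c ≠ a) (n : ℕ) :
    ∀ (E R Run : Finset ι) (W : Set V) (tip : V),
      2 * (E \ R).card ≤ n + Run.card →
      (∀ i ∈ E, ¬ (ends i).IsDiag) →
      (∀ u, u ≠ c → u ≠ a → ∀ i j k, i ∈ E → j ∈ E → k ∈ E → u ∈ ends i → u ∈ ends j → u ∈ ends k → i = j ∨ i = k ∨ j = k) →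
      R ⊆ E →
      (∀ u, u ≠ c → u ≠ a → ∀ i ∈ R, u ∈ ends i → ∀ j ∈ E, u ∈ ends j → j ∈ R) →
      Run ⊆ E → (∀ i ∈ Run, i ∉ R) →
      (∀ i ∈ Run, ∀ x, x ∈ ends i → x ∈ W ∨ x = c ∨ x = tip) →
      (∀ x ∈ W, x ∈ openCluster (ends '' (↑Run : Set ι)) c) →
      tip ∈ openCluster (ends '' (↑Run : Set ι)) c →
      (∀ x ∈ W, x ≠ c ∧ x ≠ a) →
      (∀ i ∈ E, i ∉ Run → ∀ x ∈ W, x ∈ ends i → x = tip) →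
      (tip ∈ W → ∀ i ∈ Run, ∀ j ∈ Run, tip ∈ ends i → tip ∈ ends j → i = j) →
      (tip ∈ W ∨ tip = c ∨ tip = a) →
      ∀ H Hb K Kb : Set V → ℝ, Monotone H → Monotone Hb → Monotone K → Monotone Kb →
        (∀ X, Hb X ≤ H X) → (∀ X, Kb X ≤ K X) →
        0 ≤ ∑ ω ∈ E.powerset, (if R ⊆ ω ∧ (Run ⊆ ω ∨ Disjoint Run ω) ∧ a ∈ openCluster (ends '' (↑ω : Set ι)) c ∧
            a ∉ openCluster (ends '' (↑(E \ ω) : Set ι)) c then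
            (H (openCluster (ends '' (↑ω : Set ι)) c) - Hb (openCluster (ends '' (↑(E \ ω) : Set ι)) c)) *
              (K (openCluster (ends '' (↑ω : Set ι)) c) - Kb (openCluster (ends '' (↑(E \ ω) : Set ι)) c)) else 0) := by
  induction n with
  | zero =>
    intro E R Run W tip hμ _ _ _ _ hRunE hRunR _ _ _ _ _ _ _ H Hb K Kb _ mHb _ mKb hHbH hKbK
    have h1 : Run.card ≤ (E \ R).card := Finset.card_le_card fun i hi => Finset.mem_sdiff.mpr ⟨hRunE hi, hRunR i hi⟩
    have hcard : (E \ R).card = 0 := by omega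
    rw [Finset.card_eq_zero, Finset.sdiff_eq_empty_iff_subset] at hcard
    exact osr_step_base ends E R Run c a (fun i hi _ => hcard hi) H Hb K Kb mHb mKb hHbH hKbK
  | succ n ih =>
    intro E R Run W tip hμ hloop hdeg hRE hRpriv hRunE hRunR hRunW hWc htipc hWca hpriv htipuniq htri H Hb K Kb mH mHb mK mKb hHbH hKbK
    -- averaged levels are monotone and nested (used by the FREE-BIT and SLICE steps)
    have avg_mono : ∀ (F : Set V → ℝ) (T : Set V → Set V), Monotone F → (∀ Z Z' : Set V, Z ⊆ Z' → T Z ⊆ T Z') →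
        Monotone (fun Z => (F (Z ∪ W) + F (Z ∪ T Z)) / 2) := by
      intro F T hF hT Z Z' hZZ'
      have h1 : F (Z ∪ W) ≤ F (Z' ∪ W) := hF (Set.union_subset_union_left W hZZ')
      have h2 : F (Z ∪ T Z) ≤ F (Z' ∪ T Z') := hF (Set.union_subset_union hZZ' (hT Z Z' hZZ'))
      show (F (Z ∪ W) + F (Z ∪ T Z)) / 2 ≤ (F (Z' ∪ W) + F (Z' ∪ T Z')) / 2
      linarith
    have avg_mono' : ∀ (F : Set V → ℝ) (T : Set V → Set V), Monotone F → (∀ Z Z' : Set V, Z ⊆ Z' → T Z ⊆ T Z') →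
        Monotone (fun Z => (F (Z ∪ T Z) + F (Z ∪ W)) / 2) := by
      intro F T hF hT Z Z' hZZ'
      have h1 : F (Z ∪ W) ≤ F (Z' ∪ W) := hF (Set.union_subset_union_left W hZZ')
      have h2 : F (Z ∪ T Z) ≤ F (Z' ∪ T Z') := hF (Set.union_subset_union hZZ' (hT Z Z' hZZ'))
      show (F (Z ∪ T Z) + F (Z ∪ W)) / 2 ≤ (F (Z' ∪ T Z') + F (Z' ∪ W)) / 2
      linarith
    -- the induction hypothesis for an empty run on a smaller edge set `E'` (with `R ⊆ E'`)
    have ih0 : ∀ E' : Finset ι, E' ⊆ E → R ⊆ E' → 2 * (E' \ R).card ≤ n →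
        ∀ H' Hb' K' Kb' : Set V → ℝ, Monotone H' → Monotone Hb' → Monotone K' → Monotone Kb' →
        (∀ X, Hb' X ≤ H' X) → (∀ X, Kb' X ≤ K' X) →
        0 ≤ ∑ ω ∈ E'.powerset, (if R ⊆ ω ∧ (∅ ⊆ ω ∨ Disjoint ∅ ω) ∧ a ∈ openCluster (ends '' (↑ω : Set ι)) c ∧
            a ∉ openCluster (ends '' (↑(E' \ ω) : Set ι)) c then
            (H' (openCluster (ends '' (↑ω : Set ι)) c) - Hb' (openCluster (ends '' (↑(E' \ ω) : Set ι)) c)) *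
              (K' (openCluster (ends '' (↑ω : Set ι)) c) - Kb' (openCluster (ends '' (↑(E' \ ω) : Set ι)) c)) else 0) := by
      intro E' hE'E hRE' hμ' H' Hb' K' Kb' mH' mHb' mK' mKb' h1 h2
      refine ih E' R ∅ ∅ c (by simpa using hμ') (fun i hi => hloop i (hE'E hi))
        (fun u huc hua i j k hi hj hk => hdeg u huc hua i j k (hE'E hi) (hE'E hj) (hE'E hk)) hRE'
        (fun u huc hua i hi hui j hj huj => hRpriv u huc hua i hi hui j (hE'E hj) huj)
        (Finset.empty_subset _) (fun i hi => absurd hi (Finset.notMem_empty i))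
        (fun i hi => absurd hi (Finset.notMem_empty i)) (fun x hx => absurd hx (Set.notMem_empty x))
        (mem_openCluster_self _ _) (fun x hx => absurd hx (Set.notMem_empty x))
        (fun i _ _ x hx => absurd hx (Set.notMem_empty x)) (fun hx => absurd hx (Set.notMem_empty c))
        (Or.inr (Or.inl rfl)) H' Hb' K' Kb' mH' mHb' mK' mKb' h1 h2
    rcases htri with htW | htc | hta
    · ----------------------------------------------------------------- internal tip
      have htc' : tip ≠ c := (hWca tip htW).1
      have hta' : tip ≠ a := (hWca tip htW).2
      have haW : a ∉ W := fun h => (hWca a h).2 rfl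
      have hcW : c ∉ W := fun h => (hWca c h).1 rfl
      obtain ⟨e₀, he₀, htipe₀⟩ := exists_edge_of_mem_openCluster ends htipc htc'
      have hne : Run.Nonempty := ⟨e₀, he₀⟩
      have hRunW' : ∀ i ∈ Run, ∀ x, x ∈ ends i → x ∈ W ∨ x = c := by
        intro i hi x hx
        rcases hRunW i hi x hx with h | h | h
        · exact Or.inl h
        · exact Or.inr h
        · exact Or.inl (h ▸ htW)
      by_cases hf : ∃ f ∈ E, f ∉ Run ∧ tip ∈ ends f
      · --------------------------------------------------------------- SPLIT + SLICE along the next edge `f`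
        obtain ⟨f, hfE, hfRun, htipf⟩ := hf
        obtain ⟨w, hfends⟩ : ∃ w, ends f = s(tip, w) := ⟨Sym2.Mem.other htipf, (Sym2.other_spec htipf).symm⟩
        have htw : tip ≠ w := by
          intro h; apply hloop f hfE; rw [hfends, ← h]; exact Sym2.mk_isDiag_iff.mpr rfl
        have hfR : f ∉ R := fun hfR' => hRunR e₀ he₀ (hRpriv tip htc' hta' f hfR' htipf e₀ (hRunE he₀) htipe₀)
        have huniq : ∀ i ∈ E, i ∉ Run → tip ∈ ends i → i = f := by
          intro i hi hiRun htipi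
          rcases hdeg tip htc' hta' e₀ i f (hRunE he₀) hi hfE htipe₀ htipi htipf with h | h | h
          · exact absurd he₀ (h ▸ hiRun)
          · exact absurd he₀ (h ▸ hfRun)
          · exact h
        have hwW : w ∉ W := fun hwW => htw (hpriv f hfE hfRun w hwW (by rw [hfends]; exact Sym2.mem_mk_right _ _)).symm
        have hpriv' : ∀ i ∈ E, i ∉ Run → i ≠ f → ∀ x, x ∈ ends i → x ∉ W := by
          intro i hi hiRun hif x hx hxW
          have hxt : x = tip := hpriv i hi hiRun x hxW hx
          exact hif (huniq i hi hiRun (hxt ▸ hx))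
        rw [osr_split_run ends E R Run c a f hne hfRun H Hb K Kb]
        -- (1) the longer run, by induction
        have h1 := ih E R (insert f Run) (W ∪ {y | y = w ∧ w ≠ c ∧ w ≠ a}) w
          (by rw [Finset.card_insert_of_notMem hfRun]; omega) hloop hdeg hRE hRpriv (Finset.insert_subset hfE hRunE)
          (by
            intro i hi
            rcases Finset.mem_insert.mp hi with h | h
            · exact h ▸ hfR
            · exact hRunR i h)
          (by
            intro i hi x hx
            rcases Finset.mem_insert.mp hi with h | h
            · subst h
              rw [hfends, Sym2.mem_iff] at hx
              rcases hx with h | h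
              · exact Or.inl (Or.inl (h ▸ htW))
              · exact Or.inr (Or.inr h)
            · rcases hRunW i h x hx with h' | h' | h'
              · exact Or.inl (Or.inl h')
              · exact Or.inr (Or.inl h')
              · exact Or.inl (Or.inl (h' ▸ htW)))
          (by
            have htip' : tip ∈ openCluster (ends '' (↑(insert f Run) : Set ι)) c :=
              openCluster_image_mono ends (Finset.subset_insert f Run) c htipc
            rintro x (hx | ⟨hx, _⟩)
            · exact openCluster_image_mono ends (Finset.subset_insert f Run) c (hWc x hx)
            · rw [hx]; exact mem_openCluster_of_edge ends (Finset.mem_insert_self f Run) hfends htip')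
          (mem_openCluster_of_edge ends (Finset.mem_insert_self f Run) hfends
            (openCluster_image_mono ends (Finset.subset_insert f Run) c htipc))
          (by
            rintro x (hx | ⟨hx, hwc, hwa⟩)
            · exact hWca x hx
            · exact ⟨hx ▸ hwc, hx ▸ hwa⟩)
          (by
            intro i hi hiD x hx hxi
            have hiRun : i ∉ Run := fun h => hiD (Finset.mem_insert_of_mem h)
            have hif : i ≠ f := fun h => hiD (h ▸ Finset.mem_insert_self f Run)
            rcases hx with hx | ⟨hx, _⟩
            · exact absurd hx (hpriv' i hi hiRun hif x hxi)
            · exact hx)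
          (by
            intro hwW' i hi j hj hwi hwj
            have hwc : w ≠ c := by
              rcases hwW' with h | ⟨_, h, _⟩
              · exact (hWca w h).1
              · exact h
            have hnot : ∀ k ∈ Run, w ∉ ends k := by
              intro k hk hwk
              rcases hRunW k hk w hwk with h | h | h
              · exact hwW h
              · exact hwc h
              · exact htw h.symm
            rcases Finset.mem_insert.mp hi with hi' | hi'
            · rcases Finset.mem_insert.mp hj with hj' | hj'
              · rw [hi', hj']
              · exact absurd hwj (hnot j hj')
            · exact absurd hwi (hnot i hi'))
          (by
            by_cases hwc : w = c
            · exact Or.inr (Or.inl hwc)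
            · by_cases hwa : w = a
              · exact Or.inr (Or.inr hwa)
              · exact Or.inl (Or.inr ⟨rfl, hwc, hwa⟩))
          H Hb K Kb mH mHb mK mKb hHbH hKbK
        -- (2) the slice, by the SLICE STEP and induction on `E \ (Run + f)`
        have h2 := osr_step_slice ends E R Run W c a tip w f hRunE hRunR hfE hfR hfRun hfends htw hRunW' hWc hpriv' htW haW hcW
          H Hb K Kb mH mHb mK mKb
        have hT : ∀ Z Z' : Set V, Z ⊆ Z' → {y | y = tip ∧ w ∈ Z} ⊆ {y | y = tip ∧ w ∈ Z'} :=
          fun Z Z' hZZ' y ⟨hy, hw⟩ => ⟨hy, hZZ' hw⟩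
        have hDsub : insert f Run ⊆ E \ R := by
          intro i hi
          rcases Finset.mem_insert.mp hi with h | h
          · exact Finset.mem_sdiff.mpr ⟨h ▸ hfE, h ▸ hfR⟩
          · exact Finset.mem_sdiff.mpr ⟨hRunE h, hRunR i h⟩
        have hμ' : 2 * ((E \ insert f Run) \ R).card ≤ n := by
          rw [sdiff_right_comm]
          have := Finset.card_sdiff_add_card_eq_card hDsub
          rw [Finset.card_insert_of_notMem hfRun] at this
          omega
        have h3 := ih0 (E \ insert f Run) Finset.sdiff_subset
          (fun i hi => Finset.mem_sdiff.mpr ⟨hRE hi, fun h => (Finset.mem_sdiff.mp (hDsub h)).2 hi⟩) hμ'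
          (fun Z => (H (Z ∪ W) + H (Z ∪ {y | y = tip ∧ w ∈ Z})) / 2)
          (fun Z => (Hb (Z ∪ {y | y = tip ∧ w ∈ Z}) + Hb (Z ∪ W)) / 2)
          (fun Z => (K (Z ∪ W) + K (Z ∪ {y | y = tip ∧ w ∈ Z})) / 2)
          (fun Z => (Kb (Z ∪ {y | y = tip ∧ w ∈ Z}) + Kb (Z ∪ W)) / 2)
          (avg_mono H _ mH hT) (avg_mono' Hb _ mHb hT) (avg_mono K _ mK hT) (avg_mono' Kb _ mKb hT)
          (fun Z => by
            show (Hb (Z ∪ {y | y = tip ∧ w ∈ Z}) + Hb (Z ∪ W)) / 2 ≤ (H (Z ∪ W) + H (Z ∪ {y | y = tip ∧ w ∈ Z})) / 2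
            linarith [hHbH (Z ∪ W), hHbH (Z ∪ {y | y = tip ∧ w ∈ Z})])
          (fun Z => by
            show (Kb (Z ∪ {y | y = tip ∧ w ∈ Z}) + Kb (Z ∪ W)) / 2 ≤ (K (Z ∪ W) + K (Z ∪ {y | y = tip ∧ w ∈ Z})) / 2
            linarith [hKbK (Z ∪ W), hKbK (Z ∪ {y | y = tip ∧ w ∈ Z})])
        linarith [h1, h2, h3]
      · --------------------------------------------------------------- dead end: FREE BIT over the run colour
        push Not at hf
        have hprivfull : ∀ i ∈ E, i ∉ Run → ∀ x, x ∈ ends i → x ∉ W := by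
          intro i hi hiRun x hx hxW
          have hxt : x = tip := hpriv i hi hiRun x hxW hx
          exact hf i hi hiRun (hxt ▸ hx)
        have h2 := osr_step_freeBit ends E R Run W c a hRunE hRunR hne hRunW' hWc hprivfull haW H Hb K Kb mH mHb mK mKb
        have hRsub : Run ⊆ E \ R := fun i hi => Finset.mem_sdiff.mpr ⟨hRunE hi, hRunR i hi⟩
        have hμ' : 2 * ((E \ Run) \ R).card ≤ n := by
          rw [sdiff_right_comm]
          have := Finset.card_sdiff_add_card_eq_card hRsub
          have : 0 < Run.card := Finset.card_pos.mpr hne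
          omega
        have hT : ∀ Z Z' : Set V, Z ⊆ Z' → (fun _ : Set V => (∅ : Set V)) Z ⊆ (fun _ : Set V => (∅ : Set V)) Z' := fun _ _ _ => le_rfl
        have h3 := ih0 (E \ Run) Finset.sdiff_subset
          (fun i hi => Finset.mem_sdiff.mpr ⟨hRE hi, fun h => hRunR i h hi⟩) hμ'
          (fun Z => (H (Z ∪ W) + H Z) / 2) (fun Z => (Hb Z + Hb (Z ∪ W)) / 2)
          (fun Z => (K (Z ∪ W) + K Z) / 2) (fun Z => (Kb Z + Kb (Z ∪ W)) / 2)
          (fun Z Z' h => by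
            show (H (Z ∪ W) + H Z) / 2 ≤ (H (Z' ∪ W) + H Z') / 2
            linarith [mH h, mH (Set.union_subset_union_left W h)])
          (fun Z Z' h => by
            show (Hb Z + Hb (Z ∪ W)) / 2 ≤ (Hb Z' + Hb (Z' ∪ W)) / 2
            linarith [mHb h, mHb (Set.union_subset_union_left W h)])
          (fun Z Z' h => by
            show (K (Z ∪ W) + K Z) / 2 ≤ (K (Z' ∪ W) + K Z') / 2
            linarith [mK h, mK (Set.union_subset_union_left W h)])
          (fun Z Z' h => by
            show (Kb Z + Kb (Z ∪ W)) / 2 ≤ (Kb Z' + Kb (Z' ∪ W)) / 2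
            linarith [mKb h, mKb (Set.union_subset_union_left W h)])
          (fun Z => by
            show (Hb Z + Hb (Z ∪ W)) / 2 ≤ (H (Z ∪ W) + H Z) / 2
            linarith [hHbH Z, hHbH (Z ∪ W)])
          (fun Z => by
            show (Kb Z + Kb (Z ∪ W)) / 2 ≤ (K (Z ∪ W) + K Z) / 2
            linarith [hKbK Z, hKbK (Z ∪ W)])
        linarith [h2, h3]
    · ----------------------------------------------------------------- tip = c
      replace htc := htc.symm
      subst htc
      have hcW : c ∉ W := fun h => (hWca c h).1 rfl
      have haW : a ∉ W := fun h => (hWca a h).2 rfl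
      by_cases hRne : Run.Nonempty
      · --------------------------------------------------------------- closed ear: FREE BIT
        have hRunW' : ∀ i ∈ Run, ∀ x, x ∈ ends i → x ∈ W ∨ x = c := by
          intro i hi x hx
          rcases hRunW i hi x hx with h | h | h
          · exact Or.inl h
          · exact Or.inr h
          · exact Or.inr h
        have hprivfull : ∀ i ∈ E, i ∉ Run → ∀ x, x ∈ ends i → x ∉ W := by
          intro i hi hiRun x hx hxW
          exact hcW ((hpriv i hi hiRun x hxW hx) ▸ hxW)
        have h2 := osr_step_freeBit ends E R Run W c a hRunE hRunR hRne hRunW' hWc hprivfull haW H Hb K Kb mH mHb mK mKb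
        have hRsub : Run ⊆ E \ R := fun i hi => Finset.mem_sdiff.mpr ⟨hRunE hi, hRunR i hi⟩
        have hμ' : 2 * ((E \ Run) \ R).card ≤ n := by
          rw [sdiff_right_comm]
          have := Finset.card_sdiff_add_card_eq_card hRsub
          have : 0 < Run.card := Finset.card_pos.mpr hRne
          omega
        have h3 := ih0 (E \ Run) Finset.sdiff_subset
          (fun i hi => Finset.mem_sdiff.mpr ⟨hRE hi, fun h => hRunR i h hi⟩) hμ'
          (fun Z => (H (Z ∪ W) + H Z) / 2) (fun Z => (Hb Z + Hb (Z ∪ W)) / 2)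
          (fun Z => (K (Z ∪ W) + K Z) / 2) (fun Z => (Kb Z + Kb (Z ∪ W)) / 2)
          (fun Z Z' h => by
            show (H (Z ∪ W) + H Z) / 2 ≤ (H (Z' ∪ W) + H Z') / 2
            linarith [mH h, mH (Set.union_subset_union_left W h)])
          (fun Z Z' h => by
            show (Hb Z + Hb (Z ∪ W)) / 2 ≤ (Hb Z' + Hb (Z' ∪ W)) / 2
            linarith [mHb h, mHb (Set.union_subset_union_left W h)])
          (fun Z Z' h => by
            show (K (Z ∪ W) + K Z) / 2 ≤ (K (Z' ∪ W) + K Z') / 2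
            linarith [mK h, mK (Set.union_subset_union_left W h)])
          (fun Z Z' h => by
            show (Kb Z + Kb (Z ∪ W)) / 2 ≤ (Kb Z' + Kb (Z' ∪ W)) / 2
            linarith [mKb h, mKb (Set.union_subset_union_left W h)])
          (fun Z => by
            show (Hb Z + Hb (Z ∪ W)) / 2 ≤ (H (Z ∪ W) + H Z) / 2
            linarith [hHbH Z, hHbH (Z ∪ W)])
          (fun Z => by
            show (Kb Z + Kb (Z ∪ W)) / 2 ≤ (K (Z ∪ W) + K Z) / 2
            linarith [hKbK Z, hKbK (Z ∪ W)])
        linarith [h2, h3]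
      · --------------------------------------------------------------- Run = ∅: PICK the first edge of an arm, or BASE
        rw [Finset.not_nonempty_iff_eq_empty] at hRne
        subst hRne
        by_cases hfree : ∃ i ∈ E, i ∉ R ∧ c ∈ ends i
        · obtain ⟨i, hiE, hiR, hci⟩ := hfree
          obtain ⟨v, hiends⟩ : ∃ v, ends i = s(c, v) := ⟨Sym2.Mem.other hci, (Sym2.other_spec hci).symm⟩
          have hcv : c ≠ v := by
            intro h; apply hloop i hiE; rw [hiends, ← h]; exact Sym2.mk_isDiag_iff.mpr rfl
          have hvC : v ∈ openCluster (ends '' (↑({i} : Finset ι) : Set ι)) c :=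
            mem_openCluster_of_edge ends (Finset.mem_singleton_self i) hiends (mem_openCluster_self _ _)
          have h1 := ih E R {i} {y | y = v ∧ v ≠ a} v (by rw [Finset.card_singleton]; simpa using hμ) hloop hdeg hRE hRpriv
            (Finset.singleton_subset_iff.mpr hiE) (fun j hj => by rw [Finset.mem_singleton] at hj; exact hj ▸ hiR)
            (by
              intro j hj x hx
              rw [Finset.mem_singleton] at hj; subst hj
              rw [hiends, Sym2.mem_iff] at hx
              rcases hx with h | h
              · exact Or.inr (Or.inl h)
              · exact Or.inr (Or.inr h))
            (by rintro x ⟨hx, _⟩; rw [hx]; exact hvC) hvC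
            (by rintro x ⟨hx, hva⟩; exact ⟨hx ▸ (Ne.symm hcv), hx ▸ hva⟩)
            (by rintro j _ _ x ⟨hx, _⟩ _; exact hx)
            (by
              intro _ j hj k hk _ _
              rw [Finset.mem_singleton] at hj hk; rw [hj, hk])
            (by
              by_cases hva : v = a
              · exact Or.inr (Or.inr hva)
              · exact Or.inl ⟨rfl, hva⟩)
            H Hb K Kb mH mHb mK mKb hHbH hKbK
          rw [sum_ite_congr_prop E.powerset _
            (fun ω => R ⊆ ω ∧ (({i} : Finset ι) ⊆ ω ∨ Disjoint ({i} : Finset ι) ω) ∧ a ∈ openCluster (ends '' (↑ω : Set ι)) c ∧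
              a ∉ openCluster (ends '' (↑(E \ ω) : Set ι)) c) _ ?_]
          · exact h1
          · intro ω _
            have hm : ({i} : Finset ι) ⊆ ω ∨ Disjoint ({i} : Finset ι) ω := by
              by_cases hiω : i ∈ ω
              · exact Or.inl (Finset.singleton_subset_iff.mpr hiω)
              · exact Or.inr (Finset.disjoint_singleton_left.mpr hiω)
            constructor
            · rintro ⟨hR, -, hev⟩; exact ⟨hR, hm, hev⟩
            · rintro ⟨hR, -, hev⟩; exact ⟨hR, Or.inl (Finset.empty_subset _), hev⟩
        · push Not at hfree
          exact osr_step_base ends E R ∅ c a (fun i hi hci => by by_contra h; exact hfree i hi h hci) H Hb K Kb mHb mKb hHbH hKbK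
    · ----------------------------------------------------------------- tip = a: THREAD (absorb the red run)
      replace hta := hta.symm
      subst hta
      obtain ⟨e₀, he₀, _⟩ := exists_edge_of_mem_openCluster ends htipc (Ne.symm hca)
      have hne : Run.Nonempty := ⟨e₀, he₀⟩
      rw [osr_step_thread ends E R Run c a hRunE htipc]
      have hRsub : Run ⊆ E \ R := fun i hi => Finset.mem_sdiff.mpr ⟨hRunE hi, hRunR i hi⟩
      have hER : E \ (R ∪ Run) = (E \ R) \ Run := by
        ext i; simp only [Finset.mem_sdiff, Finset.mem_union, not_or]; tauto
      have hμ' : 2 * (E \ (R ∪ Run)).card ≤ n + (∅ : Finset ι).card := by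
        rw [hER, Finset.card_empty]
        have := Finset.card_sdiff_add_card_eq_card hRsub
        have : 0 < Run.card := Finset.card_pos.mpr hne
        omega
      refine ih E (R ∪ Run) ∅ ∅ c hμ' hloop hdeg (Finset.union_subset hRE hRunE) ?_
        (Finset.empty_subset _) (fun i hi => absurd hi (Finset.notMem_empty i))
        (fun i hi => absurd hi (Finset.notMem_empty i)) (fun x hx => absurd hx (Set.notMem_empty x))
        (mem_openCluster_self _ _) (fun x hx => absurd hx (Set.notMem_empty x))
        (fun i _ _ x hx => absurd hx (Set.notMem_empty x)) (fun hx => absurd hx (Set.notMem_empty c))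
        (Or.inr (Or.inl rfl)) H Hb K Kb mH mHb mK mKb hHbH hKbK
      -- the enlarged absorbed set stays private
      intro u huc hua i hi hui j hj huj
      rcases Finset.mem_union.mp hi with hi' | hi'
      · exact Finset.mem_union_left _ (hRpriv u huc hua i hi' hui j hj huj)
      · have huW : u ∈ W := by
          rcases hRunW i hi' u hui with h | h | h
          · exact h
          · exact absurd h huc
          · exact absurd h hua
        by_cases hjRun : j ∈ Run
        · exact Finset.mem_union_right _ hjRun
        · exact absurd (hpriv j hj hjRun u huW huj) hua

end Coefficientwise

end Summit.CriticalPhenomena.PercolationContinuityZ3.Theorems
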